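import Summits.NavierStokesRegularity.FluidComputer.ClayBlowupL3Concentration
import Literature.Analysis.FluidPDE.ESSLocalHolderTopCylinderContinuous
import HarnessLib

/-!
# THE BLOW-UP PROFILE OF AN UNFORCED CLAY BLOW-UP: off its compact `ℋ¹`-null singular slice the
# velocity converges, as `t ↑ T`, to a CONTINUOUS profile `u(T, ·)`

Cell `ns-blowup`, seat `ns-blowup-ecbridge-2` (g8; the E–C endpoint theory seat). LABEL: E–C typing,
(A)-side (KERNEL — no named fact, no new definition). WHAT THIS IS NOT: not Navier–Stokes evidence — a
structural necessary condition on the UNFORCED inhabitants of `ClayBlowup ν` (the counterexamples to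
Fefferman's (A)); no inhabitant is claimed. Companion memo:
`run/shared/lean/pub/ns-blowup/ecbridge2/ECBRIDGE-2-MEMO-7.md`.

## Content (Leray's «époque d'irrégularité», the regular part of the final slice)

For an unforced Clay blow-up `X` (`ν > 0`, `X.f = 0`) the singular slice
`S_T = {x | ¬ IsBackwardBoundedAt u T x}` is a nonempty compact `ℋ¹`-null set (g6/g7). At every OTHER
point the solution is continuous UP TO AND INCLUDING the blow-up time:

* `ClayBlowup.exists_continuousOn_closure_cylinder` — at a backward bounded point `x₀` there are
  `r > 0` (`r² ≤ T`) and `W` continuous on the CLOSED cylinder `closure Q_r(T, x₀)` with `u = W`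
  pointwise on `Q_r(T, x₀)`: boundedness on a backward cylinder gives the local `L^∞_t L³_x` bound, and
  Escauriaza–Seregin–Šverák's Thm. 1.4 at the top (`ess_continuousOn_near_top_of_L3`, g8, fed with g6's
  `exists_isLRSuitableWeakSolutionOn_cylinder_top`) gives a representative continuous up to the top,
  which agrees with the classical `u` on the open cylinder (`Measure.eqOn_open_of_ae_eq`);
* `ClayBlowup.tendsto_top_of_mem_ball` — hence `u(t, y) → W(T, x)` as `(t, y) → (T, x)`, `t < T`, for
  every `x ∈ B(x₀, r)`;
* **`ClayBlowup.exists_blowupProfile`** — there is a profile `U : ℝ³ → ℝ³`, CONTINUOUS on the regular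
  set `{x | IsBackwardBoundedAt u T x} = ℝ³ ∖ S_T`, with `u(t, y) → U(x)` as `(t, y) → (T, x)` from
  below for every regular `x`; in particular `u(t, x) → U(x)` as `t ↑ T` (`tendsto_slice_blowupProfile`).

So the final state of a ¬(A) witness is a continuous vector field on the complement of a compact
`ℋ¹`-null set, attained locally uniformly; all the divergence (`‖u(t)‖_∞ → ∞`, `‖u(t)‖₃` unbounded,
enstrophy `→ ∞`) happens at `S_T`.

References: J. Leray, Acta Math. 63 (1934), §32 [cite: Leray1934, §32]; L. Escauriaza, G. Seregin,
V. Šverák, Russ. Math. Surveys 58 (2003), Thm. 1.4 [cite: EscauriazaSereginSverak2003, Thm. 1.4];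
L. Caffarelli, R. Kohn, L. Nirenberg, CPAM 35 (1982), §6 [cite: CaffarelliKohnNirenberg1982, §6];
C. L. Fefferman, Clay problem description, (A) [cite: FeffermanClay2006, (A)].
-/

noncomputable section

namespace Summit.NavierStokesRegularity.FluidComputer

open Set MeasureTheory Filter Topology Function Metric TopologicalSpace
open scoped ENNReal NNReal
open Literature.Analysis.FluidPDE
open Summit.NavierStokesRegularity.NavierStokesRegularity

namespace ClayBlowup

variable {ν : ℝ} (X : ClayBlowup ν)

/-! ## §1 A continuous representative up to the top at every regular point -/

/-- **At a backward bounded point an unforced Clay blow-up is continuous up to the blow-up time**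
(`ν > 0`, `f = 0`; no named fact): there are `r > 0` with `r² ≤ T` and `W : ℝ × ℝ³ → ℝ³` continuous on
`closure Q_r(T, x₀)` with `u(t, y) = W(t, y)` for all `(t, y) ∈ Q_r(T, x₀)`. [cite: EscauriazaSereginSverak2003, Thm. 1.4] -/
theorem exists_continuousOn_closure_cylinder (hν : 0 < ν) (hf : X.f = 0)
    {x₀ : EuclideanSpace ℝ (Fin 3)} (hx₀ : IsBackwardBoundedAt X.u X.T x₀) :
    ∃ r : ℝ, 0 < r ∧ r ^ 2 ≤ X.T ∧ ∃ W : ℝ × EuclideanSpace ℝ (Fin 3) → EuclideanSpace ℝ (Fin 3),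
      ContinuousOn W (closure (parabolicCylinder r ((X.T : ℝ), x₀))) ∧
        ∀ z ∈ parabolicCylinder r ((X.T : ℝ), x₀), uncurry X.u z = W z := by
  have hT := X.T_pos
  obtain ⟨r₀, hr₀, C, hC⟩ := hx₀
  -- a radius with `r² ≤ T`
  set r : ℝ := min r₀ (Real.sqrt X.T) with hr
  have hrpos : 0 < r := lt_min hr₀ (Real.sqrt_pos.2 hT)
  have hrr₀ : r ≤ r₀ := min_le_left _ _
  have hrT : r ^ 2 ≤ X.T := by
    calc r ^ 2 ≤ Real.sqrt X.T ^ 2 := pow_le_pow_left₀ hrpos.le (min_le_right _ _) 2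
      _ = X.T := Real.sq_sqrt hT.le
  have hC0 : 0 ≤ C := by
    have ht : X.T - r ^ 2 / 2 ∈ Ioo (X.T - r₀ ^ 2) X.T := by
      have : r ^ 2 ≤ r₀ ^ 2 := pow_le_pow_left₀ hrpos.le hrr₀ 2
      constructor <;> nlinarith
    exact (norm_nonneg _).trans (hC _ ht x₀ (mem_ball_self hr₀))
  -- the local `L^∞_t L³_x` bound from the pointwise bound
  have hL3 : ∃ C' : ℝ≥0, ∀ᵐ t ∂(volume.restrict (Ioo (X.T - r ^ 2) X.T)),
      ∫⁻ x in ball x₀ r, ‖X.u t x‖ₑ ^ 3 ≤ C' := by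
    have hvol : volume (ball x₀ r) < ⊤ := measure_ball_lt_top
    set K : ℝ≥0∞ := ENNReal.ofReal C ^ 3 * volume (ball x₀ r) with hK
    have hKt : K ≠ ⊤ := ENNReal.mul_ne_top (ENNReal.pow_ne_top ENNReal.ofReal_ne_top) hvol.ne
    refine ⟨K.toNNReal, (ae_restrict_iff' measurableSet_Ioo).2 (ae_of_all _ fun t ht => ?_)⟩
    rw [ENNReal.coe_toNNReal hKt]
    have ht' : t ∈ Ioo (X.T - r₀ ^ 2) X.T := by
      have : r ^ 2 ≤ r₀ ^ 2 := pow_le_pow_left₀ hrpos.le hrr₀ 2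
      exact ⟨by linarith [ht.1], ht.2⟩
    calc ∫⁻ x in ball x₀ r, ‖X.u t x‖ₑ ^ 3
        ≤ ∫⁻ _ in ball x₀ r, ENNReal.ofReal C ^ 3 := by
          refine setLIntegral_mono' measurableSet_ball fun x hx => ?_
          have h1 : ‖X.u t x‖ₑ ≤ ENNReal.ofReal C := by
            rw [← ofReal_norm]
            exact ENNReal.ofReal_le_ofReal (hC t ht' x (ball_subset_ball hrr₀ hx))
          exact pow_le_pow_left' h1 3
      _ = K := by rw [setLIntegral_const, hK, mul_comm]
  -- the §14.3 datum with zero force on `Q_r(T, x₀)` and ESS at the top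
  obtain ⟨G, hLR⟩ := X.exists_isLRSuitableWeakSolutionOn_cylinder_top hν x₀ hrpos hrT
  rw [hf] at hLR
  obtain ⟨r₁, hr₁, W, hWc, hae⟩ := ess_continuousOn_near_top_of_L3 hν hLR hL3 ((X.T : ℝ), x₀)
    ⟨by simp only; nlinarith, le_rfl⟩ (mem_ball_self hrpos)
  -- the final radius `r₂ = min r₁ r`
  set r₂ : ℝ := min r₁ r with hr₂
  have hr₂pos : 0 < r₂ := lt_min hr₁ hrpos
  have hr₂r₁ : r₂ ≤ r₁ := min_le_left _ _
  have hr₂r : r₂ ≤ r := min_le_right _ _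
  have hsub₁ : parabolicCylinder r₂ ((X.T : ℝ), x₀) ⊆ parabolicCylinder r₁ ((X.T : ℝ), x₀) := by
    intro w hw
    rw [mem_parabolicCylinder] at hw ⊢
    have : r₂ ^ 2 ≤ r₁ ^ 2 := pow_le_pow_left₀ hr₂pos.le hr₂r₁ 2
    exact ⟨⟨by linarith [hw.1.1], hw.1.2⟩, hw.2.trans_le hr₂r₁⟩
  refine ⟨r₂, hr₂pos, (pow_le_pow_left₀ hr₂pos.le hr₂r 2).trans hrT, W,
    hWc.mono (closure_mono hsub₁), ?_⟩
  -- a.e. equality on the open cylinder plus continuity of both sides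
  have hcont : ContinuousOn (uncurry X.u) (parabolicCylinder r₂ ((X.T : ℝ), x₀)) := by
    refine X.classical.smooth_velocity.continuousOn.mono fun w hw => ?_
    rw [mem_parabolicCylinder] at hw
    have : r₂ ^ 2 ≤ X.T := (pow_le_pow_left₀ hr₂pos.le hr₂r 2).trans hrT
    exact ⟨⟨by nlinarith [hw.1.1], hw.1.2⟩, mem_univ _⟩
  have hWc' : ContinuousOn W (parabolicCylinder r₂ ((X.T : ℝ), x₀)) :=
    (hWc.mono (closure_mono hsub₁)).mono subset_closure
  exact Measure.eqOn_open_of_ae_eq (ae_restrict_of_ae_restrict_of_subset hsub₁ hae)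
    (isOpen_parabolicCylinder _ _) hcont hWc'

/-! ## §2 Limits at the top -/

/-- The top centre-line points `(T, x)`, `x ∈ B̄(x₀, r)`, lie in the closure of `Q_r(T, x₀)` (`r > 0`).
[folklore] -/
theorem mem_closure_parabolicCylinder_top {r T : ℝ} (hr : 0 < r) {x₀ x : EuclideanSpace ℝ (Fin 3)}
    (hx : x ∈ closedBall x₀ r) : ((T : ℝ), x) ∈ closure (parabolicCylinder r ((T : ℝ), x₀)) := by
  rw [parabolicCylinder, closure_prod_eq, closure_Ioo (by nlinarith : T - r ^ 2 ≠ T), closure_ball x₀ hr.ne']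
  exact ⟨⟨by nlinarith, le_rfl⟩, hx⟩

/-- Near a top point `(T, x)` with `x ∈ B(x₀, r)`, the half-space `{t < T}` and the cylinder
`Q_r(T, x₀)` define the same filter: `𝓝[{t < T} × ℝ³] (T, x) = 𝓝[Q_r(T, x₀)] (T, x)`. [folklore] -/
theorem nhdsWithin_below_eq_nhdsWithin_cylinder {r T : ℝ} (hr : 0 < r)
    {x₀ x : EuclideanSpace ℝ (Fin 3)} (hx : x ∈ ball x₀ r) :
    𝓝[Iio T ×ˢ (univ : Set (EuclideanSpace ℝ (Fin 3)))] ((T : ℝ), x) =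
      𝓝[parabolicCylinder r ((T : ℝ), x₀)] ((T : ℝ), x) := by
  have hN : Ioo (T - r ^ 2) (T + 1) ×ˢ ball x₀ r ∈ 𝓝 (((T : ℝ), x) : ℝ × EuclideanSpace ℝ (Fin 3)) :=
    prod_mem_nhds (Ioo_mem_nhds (by nlinarith) (by linarith)) (isOpen_ball.mem_nhds hx)
  rw [nhdsWithin_restrict' _ hN]
  congr 1
  ext w
  simp only [mem_inter_iff, mem_prod, mem_Iio, mem_univ, and_true, mem_Ioo, mem_parabolicCylinder,
    mem_ball]
  constructor
  · rintro ⟨h1, ⟨h2, -⟩, h3⟩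
    exact ⟨⟨h2, h1⟩, h3⟩
  · rintro ⟨⟨h2, h1⟩, h3⟩
    exact ⟨h1, ⟨h2, by linarith⟩, h3⟩

/-- **The velocity of an unforced Clay blow-up has a limit at `(T, x)` from below, for every `x` in the
ball of a continuous representative**: with `r, W` as in `exists_continuousOn_closure_cylinder` at `x₀`
and `x ∈ B(x₀, r)`, `u(t, y) → W(T, x)` as `(t, y) → (T, x)` with `t < T`. [cite: EscauriazaSereginSverak2003, Thm. 1.4] -/
theorem tendsto_top_of_mem_ball {r : ℝ} (hr : 0 < r) {x₀ : EuclideanSpace ℝ (Fin 3)}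
    {W : ℝ × EuclideanSpace ℝ (Fin 3) → EuclideanSpace ℝ (Fin 3)}
    (hWc : ContinuousOn W (closure (parabolicCylinder r ((X.T : ℝ), x₀))))
    (hWu : ∀ z ∈ parabolicCylinder r ((X.T : ℝ), x₀), uncurry X.u z = W z)
    {x : EuclideanSpace ℝ (Fin 3)} (hx : x ∈ ball x₀ r) :
    Tendsto (uncurry X.u) (𝓝[Iio X.T ×ˢ (univ : Set (EuclideanSpace ℝ (Fin 3)))] ((X.T : ℝ), x))
      (𝓝 (W ((X.T : ℝ), x))) := by
  rw [nhdsWithin_below_eq_nhdsWithin_cylinder hr hx]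
  have hmem := mem_closure_parabolicCylinder_top (T := X.T) hr (ball_subset_closedBall hx)
  have hW : Tendsto W (𝓝[parabolicCylinder r ((X.T : ℝ), x₀)] ((X.T : ℝ), x)) (𝓝 (W ((X.T : ℝ), x))) :=
    ((hWc _ hmem).mono subset_closure).tendsto
  exact hW.congr' (eventually_mem_nhdsWithin.mono fun z hz => (hWu z hz).symm)

/-! ## §3 The profile -/

/-- **THE BLOW-UP PROFILE OF AN UNFORCED CLAY BLOW-UP** (`ν > 0`, `f = 0`; no named fact, no new
definition): there is `U : ℝ³ → ℝ³`, continuous on the regular set `{x | IsBackwardBoundedAt u T x}`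
(the complement of the compact `ℋ¹`-null singular slice), such that for every regular `x`,
`u(t, y) → U(x)` as `(t, y) → (T, x)` with `t < T`. (Off the regular set the values of `U` are junk.)
[cite: Leray1934, §32] [cite: EscauriazaSereginSverak2003, Thm. 1.4] [cite: CaffarelliKohnNirenberg1982, §6] -/
theorem exists_blowupProfile (hν : 0 < ν) (hf : X.f = 0) :
    ∃ U : EuclideanSpace ℝ (Fin 3) → EuclideanSpace ℝ (Fin 3),
      ContinuousOn U {x | IsBackwardBoundedAt X.u X.T x} ∧
        ∀ x : EuclideanSpace ℝ (Fin 3), IsBackwardBoundedAt X.u X.T x →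
          Tendsto (uncurry X.u) (𝓝[Iio X.T ×ˢ (univ : Set (EuclideanSpace ℝ (Fin 3)))] ((X.T : ℝ), x))
            (𝓝 (U x)) := by
  classical
  -- the limit at each regular point (any representative gives the same value)
  have hlim : ∀ x : EuclideanSpace ℝ (Fin 3), IsBackwardBoundedAt X.u X.T x →
      ∃ v : EuclideanSpace ℝ (Fin 3),
        Tendsto (uncurry X.u) (𝓝[Iio X.T ×ˢ (univ : Set (EuclideanSpace ℝ (Fin 3)))] ((X.T : ℝ), x))
          (𝓝 v) := by
    intro x hx
    obtain ⟨r, hr, -, W, hWc, hWu⟩ := X.exists_continuousOn_closure_cylinder hν hf hx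
    exact ⟨W ((X.T : ℝ), x), X.tendsto_top_of_mem_ball hr hWc hWu (mem_ball_self hr)⟩
  set U : EuclideanSpace ℝ (Fin 3) → EuclideanSpace ℝ (Fin 3) := fun x =>
    if hx : IsBackwardBoundedAt X.u X.T x then (hlim x hx).choose else 0 with hU
  have hUlim : ∀ x : EuclideanSpace ℝ (Fin 3), IsBackwardBoundedAt X.u X.T x →
      Tendsto (uncurry X.u) (𝓝[Iio X.T ×ˢ (univ : Set (EuclideanSpace ℝ (Fin 3)))] ((X.T : ℝ), x))
        (𝓝 (U x)) := by
    intro x hx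
    have e : U x = (hlim x hx).choose := by simp only [hU, dif_pos hx]
    rw [e]
    exact (hlim x hx).choose_spec
  -- the filters are nontrivial: `(T, x)` is in the closure of the lower half-space
  have hbot : ∀ x : EuclideanSpace ℝ (Fin 3),
      (𝓝[Iio X.T ×ˢ (univ : Set (EuclideanSpace ℝ (Fin 3)))] ((X.T : ℝ), x)).NeBot := by
    intro x
    rw [← mem_closure_iff_nhdsWithin_neBot, closure_prod_eq, closure_Iio, closure_univ]
    exact ⟨self_mem_Iic, mem_univ _⟩
  refine ⟨U, ?_, hUlim⟩
  -- continuity on the regular set: near `x₀`, `U = W(T, ·)` for ONE representative `W`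
  intro x₀ hx₀
  obtain ⟨r, hr, -, W, hWc, hWu⟩ := X.exists_continuousOn_closure_cylinder hν hf hx₀
  have hreg : ∀ x ∈ ball x₀ r, IsBackwardBoundedAt X.u X.T x := by
    intro x hx
    -- the cylinder `Q_{r'}(T, x)`, `r' = r - dist x x₀`, lies in `Q_r(T, x₀)`, where `u = W` is bounded
    obtain ⟨M, hM⟩ := ((isCompact_Icc.prod (isCompact_closedBall x₀ r)).of_isClosed_subset
      isClosed_closure (closure_parabolicCylinder_subset r ((X.T : ℝ), x₀))).exists_bound_of_continuousOn hWc
    set r' : ℝ := r - dist x x₀ with hr'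
    have hr'0 : 0 < r' := sub_pos.2 (mem_ball.1 hx)
    refine ⟨r', hr'0, M, fun t ht y hy => ?_⟩
    have hz : ((t, y) : ℝ × EuclideanSpace ℝ (Fin 3)) ∈ parabolicCylinder r ((X.T : ℝ), x₀) := by
      rw [mem_parabolicCylinder]
      have h1 : r' ≤ r := by rw [hr']; linarith [dist_nonneg (x := x) (y := x₀)]
      have h2 : r' ^ 2 ≤ r ^ 2 := pow_le_pow_left₀ hr'0.le h1 2
      refine ⟨⟨by simp only; linarith [ht.1], ht.2⟩, ?_⟩
      calc dist y x₀ ≤ dist y x + dist x x₀ := dist_triangle _ _ _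
        _ < r' + dist x x₀ := by linarith [mem_ball.1 hy]
        _ = r := by rw [hr']; ring
    have := hM (t, y) (subset_closure hz)
    rw [← hWu (t, y) hz] at this
    exact this
  have hUeq : ∀ x ∈ ball x₀ r, U x = W ((X.T : ℝ), x) := fun x hx =>
    tendsto_nhds_unique' (hbot x) (hUlim x (hreg x hx)) (X.tendsto_top_of_mem_ball hr hWc hWu hx)
  -- `x ↦ W(T, x)` is continuous at `x₀`
  have hWT : ContinuousWithinAt (fun x => W ((X.T : ℝ), x)) (ball x₀ r) x₀ := by
    have hmaps : MapsTo (fun x : EuclideanSpace ℝ (Fin 3) => (((X.T : ℝ), x) : ℝ × EuclideanSpace ℝ (Fin 3)))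
        (ball x₀ r) (closure (parabolicCylinder r ((X.T : ℝ), x₀))) := fun x hx =>
      mem_closure_parabolicCylinder_top (T := X.T) hr (ball_subset_closedBall hx)
    exact (hWc _ (hmaps (mem_ball_self hr))).comp
      (Continuous.prodMk_right (X.T : ℝ)).continuousWithinAt hmaps
  have hcont : ContinuousWithinAt U (ball x₀ r) x₀ :=
    hWT.congr (fun x hx => hUeq x hx) (hUeq x₀ (mem_ball_self hr))
  exact (hcont.continuousAt (isOpen_ball.mem_nhds (mem_ball_self hr))).continuousWithinAt

/-- **Pointwise form: `u(t, x) → U(x)` as `t ↑ T` at every regular point `x`**, with `U` the blow-up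
profile of `exists_blowupProfile`. [cite: Leray1934, §32] -/
theorem tendsto_slice_blowupProfile (hν : 0 < ν) (hf : X.f = 0) :
    ∃ U : EuclideanSpace ℝ (Fin 3) → EuclideanSpace ℝ (Fin 3),
      ContinuousOn U {x | IsBackwardBoundedAt X.u X.T x} ∧
        ∀ x : EuclideanSpace ℝ (Fin 3), IsBackwardBoundedAt X.u X.T x →
          Tendsto (fun t => X.u t x) (𝓝[<] X.T) (𝓝 (U x)) := by
  obtain ⟨U, hUc, hU⟩ := X.exists_blowupProfile hν hf
  refine ⟨U, hUc, fun x hx => ?_⟩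
  have hpath : Tendsto (fun t : ℝ => ((t, x) : ℝ × EuclideanSpace ℝ (Fin 3))) (𝓝[<] X.T)
      (𝓝[Iio X.T ×ˢ (univ : Set (EuclideanSpace ℝ (Fin 3)))] ((X.T : ℝ), x)) := by
    refine tendsto_nhdsWithin_of_tendsto_nhds_of_eventually_within _
      ((Continuous.prodMk_left x).tendsto X.T |>.mono_left nhdsWithin_le_nhds) ?_
    exact eventually_mem_nhdsWithin.mono fun t ht => ⟨ht, mem_univ _⟩
  exact (hU x hx).comp hpath

end ClayBlowup

end Summit.NavierStokesRegularity.FluidComputer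

end
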